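import Literature.Probability.RandomPlanarGeometry.ConformalRestrictionLeaf
import Literature.Probability.RandomPlanarGeometry.SLERestrictionSlidHull
import Literature.Probability.RandomPlanarGeometry.SmoothArcApproximation
import Literature.Probability.RandomPlanarGeometry.SLEBoundaryHittingProofs
import Literature.Probability.RandomPlanarGeometry.SLETraceMeasurable
import HarnessLib

/-!
# [LSW] Theorem 6.1 transposed (`IsSLELaw.hullRestriction_eightThirds`) from its leaf facts

Proof-only file. G. F. Lawler, O. Schramm, W. Werner, *Conformal restriction: the chordal
case*, J. Amer. Math. Soc. **16** (2003) 917–955, arXiv:math/0209343 (**[LSW]**), Thm. 6.1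
(p. 23 of the arXiv version): "Let `γ` be the SLE_{8/3} path starting at the origin and
`A ∈ 𝒬*`, then `P[γ[0, ∞) ∩ A = ∅] = Φ'_A(0)^{5/8}`. The law of `γ(0, ∞)` is therefore
`P_{5/8}`."

The named fact `Literature.Probability.RandomPlanarGeometry.IsSLELaw.hullRestriction_eightThirds`
(`ConformalRestrictionProofs`) is the transposition of this theorem to the chordal SLE_{8/3} laws
of Dobrushin domains (two-sided restriction over hull subdomains). The tree reduces it in two
proved steps,

* `IsSLELaw.hullRestriction_eightThirds_of_facts` (`HullRestrictionSLE`): from the half-plane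
  form `sle_restriction_eightThirds` (= Thm. 6.1 verbatim) and classical facts, and
* `sle_restriction_eightThirds_of_printed_facts` (`SLERestrictionSlidHull`): Thm. 6.1 from the
  ingredients of its printed proof (§6: Prop. 5.2/5.3, Lemmas 6.2, 6.3, 2.1),

most of whose hypotheses are by now theorems of the tree. This file records the assembled
reduction **to the leaf facts that remain named facts**, so that the status of the fact is one
theorem:

* `Literature.Probability.RandomPlanarGeometry.IsSLELaw.hullRestriction_eightThirds_of_leaf_facts` —
  `IsSLELaw.hullRestriction_eightThirds` follows from SEVEN named facts: on the Rohde–Schramm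
  side `hasSLETrace_eight` (Lawler–Schramm–Werner (2004) Thm. 4.7, entering only through the
  all-`κ` quantification of SLE scaling in law, `identDistrib_sleTrace_scale_of_trace_theorems`),
  `hasSLETrace_of_ne_eight` (RS05 Thm. 5.1), `tendsto_norm_sleTrace_atTop` (RS05 Thm. 7.1),
  `ae_isSimpleTrace_sleTrace_of_le_four` at `κ = 8/3` (RS05 Thm. 6.1); and from [LSW] §§5–6
  `sle_exists_isRestrictionMartingale` (Prop. 5.2/5.3: `h_t'(W_t)^{5/8}` is a bounded
  martingale), `Loewner.restrictionDeriv_exitTime_gt` (Lemma 6.2) and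
  `IsSmoothHull.restrictionDerivVanishesAtHit` (Lemma 6.3).

Discharged inputs fed by their proofs: uniqueness/existence of `Φ_A` and `Φ'_A(0)`
(`IsStarHull.existsUnique_isRestrictionMap_holds`, `IsStarHull.exists_hasRestrictionDeriv_holds`),
kernel continuity of `Φ'_·(0)` (`HasRestrictionDeriv.tendsto_of_kernel_holds`), Lemma 2.1
(`IsPlusHull.exists_antitone_isSmoothHull_holds`), swallowing = hitting of real rays
(`sle_swallowingTime_ofReal_eq_firstHit_holds`), marginal measurability of the trace
(`aemeasurable_sleTrace_holds`), Kolmogorov extension (`isProjectiveLimit_preWienerMeasure_holds`),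
the Jordan curve theorem, arc non-separation, simple connectivity of Jordan domains, Conway
VIII.2.2, the Riemann mapping theorem and Carathéodory's theorem.
-/

noncomputable section

open scoped NNReal

namespace Literature.Probability.RandomPlanarGeometry

/-- **[LSW] Thm. 6.1 transposed to Dobrushin domains, from seven leaf facts.**
`IsSLELaw.hullRestriction_eightThirds` — for the chordal SLE_{8/3} laws `μ`, `μ'` of `(D; a, b)`
and of a hull subdomain `D'`, `μ' (T) · μ {Γ ⊆ cl D'} = μ (T ∩ {Γ ⊆ cl D'})` for every Borel `T`
— follows from: SLE₈ is generated by a curve (`h8`, only through SLE scaling in law for all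
`κ`), SLE_κ is generated by a curve for `κ ≠ 8` (`hne`), transience of the trace (`htr`),
simplicity of the SLE_{8/3} trace (`h₆`), and from [LSW] §§5–6 the restriction martingale
(`hM`, Prop. 5.2/5.3), Lemma 6.2 (`h62`) and Lemma 6.3 (`h63`); everything else in the printed
proof and in the transposition is a theorem of the tree (see the module docstring).
[cite: LawlerSchrammWerner2003Restriction, Thm. 6.1 (p. 23) and its proof (§6), with Prop. 3.3 (p. 11)] -/
theorem IsSLELaw.hullRestriction_eightThirds_of_leaf_facts (h8 : hasSLETrace_eight)
    (hne : hasSLETrace_of_ne_eight) (htr : tendsto_norm_sleTrace_atTop)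
    (h₆ : RandomPlanarGeometry.ae_isSimpleTrace_sleTrace_of_le_four (κ := (8 : ℝ≥0) / 3))
    (hM : sle_exists_isRestrictionMartingale) (h62 : Loewner.restrictionDeriv_exitTime_gt)
    (h63 : IsSmoothHull.restrictionDerivVanishesAtHit) : IsSLELaw.hullRestriction_eightThirds := by
  haveI : Fact Process.isProjectiveLimit_preWienerMeasure := ⟨isProjectiveLimit_preWienerMeasure_holds⟩
  have hC : JordanDomain.exists_continuousOn_extension :=
    JordanDomain.exists_continuousOn_extension_of_jordanCurveTheorem
      Literature.Topology.PlaneTopology.JordanCurveTheorem_holds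
  have hgen : HasSLETrace ((8 : ℝ≥0) / 3) := hasSLETrace h8 hne _
  have hscale : identDistrib_sleTrace_scale := identDistrib_sleTrace_scale_of_trace_theorems h8 hne
  have h61 : sle_restriction_eightThirds :=
    sle_restriction_eightThirds_of_printed_facts IsStarHull.existsUnique_isRestrictionMap_holds
      IsStarHull.exists_hasRestrictionDeriv_holds hM h62 h63
      IsPlusHull.exists_antitone_isSmoothHull_holds hgen h₆ htr
      sle_swallowingTime_ofReal_eq_firstHit_holds (aemeasurable_sleTrace_holds hgen)
  exact IsSLELaw.hullRestriction_eightThirds_of_facts h61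
    IsStarHull.existsUnique_isRestrictionMap_holds IsStarHull.exists_hasRestrictionDeriv_holds
    HasRestrictionDeriv.tendsto_of_kernel_holds isSimplyConnected_of_isConnected_compl_holds
    JordanDomain.isSimplyConnected_holds Literature.Topology.PlaneTopology.JordanCurveTheorem_holds
    Literature.Topology.PlaneTopology.JordanArcSeparation_holds exists_conformalEquiv_ball_holds hC
    hgen h₆ htr (IsSLECurve.map_eq_of_sleScaling hscale) aemeasurable_sleTrace_holds

end Literature.Probability.RandomPlanarGeometry

end
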